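import Mathlib

/-!
# Reflection route — precise statements of the residual conjectures (crux `HyperoctahedralThreshold`, lead c3, 2026-08-16)

Companion to crux NOTES §15 (`Cruxes/HyperoctahedralThreshold/NOTES.md`).  This file only STATES, as `Prop`s, the objects of the
same-colour reflection route so that planners / siege seats can quote them by name; nothing here is registered as a stub and nothing is
claimed proved.  Landed pieces of the route: `stub_rotationIdentity` (p111510, Theorems/…RotationIdentity.lean),
`stub_sameColourSupply` (p112303, Theorems/…StubSameColourSupply.lean); delegated: `stub_shortEvenCycleGadget`,
`stub_sameColourStructureWalk`.

Conventions: colours `μ b` (involutions of `Fin n`) act on the right, `x · w := w.foldl (fun v b => μ b v) x`; words are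
`List (Fin 3)`; "reduced" = `List.IsChain (· ≠ ·)`, "cyclically reduced" = `List.IsChain (· ≠ ·) (z ++ z)`.
-/

set_option linter.dupNamespace false

namespace Summit.MatrixMultiplication.MatrixMultiplication.Cruxes.HyperoctahedralThreshold.ReflectionRoute

open Finset

variable {n : ℕ}

/-- All words of length `m`. -/
def words (m : ℕ) : Finset (List (Fin 3)) :=
  (Finset.univ : Finset (List.Vector (Fin 3) m)).image (fun v => v.toList)

/-- Based closed walks of length `m`: pairs `(z, x)` with `z` cyclically reduced of length `m` and `x · z = x`.
Its cardinality is `T_m` of the crux NOTES. -/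
def closedWalks (μ : Fin 3 → Equiv.Perm (Fin n)) (m : ℕ) : Finset (List (Fin 3) × Fin n) :=
  ((words m).filter (fun z => List.IsChain (· ≠ ·) (z ++ z)) ×ˢ (Finset.univ : Finset (Fin n))).filter
    (fun zx => zx.1.foldl (fun v b => μ b v) zx.2 = zx.2)

/-- LOCAL HITS at radius `R` (crux NOTES §15.2): based closed walks `(z, x)` of length `m` together with two words `a ≠ []`, `b`
of length `≤ R` such that the closed walk `z` maps the nearby point `x · a` to the nearby point `x · b`
(`a = b`: a local twin; `a ≠ b`: a local shift; tips of §9 D2 are the case `|a| = |b| = 1`). -/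
def localHits (μ : Fin 3 → Equiv.Perm (Fin n)) (m R : ℕ) : ℕ :=
  ∑ zx ∈ closedWalks μ m,
    (((Finset.range (R + 1)).biUnion words ×ˢ (Finset.range (R + 1)).biUnion words).filter
      (fun ab => ab.1 ≠ [] ∧
        zx.1.foldl (fun v b => μ b v) (ab.1.foldl (fun v b => μ b v) zx.2) = ab.2.foldl (fun v b => μ b v) zx.2)).card

/-- RICH at threshold `N` and length `≤ L`: some cyclically reduced non-empty word of length `≤ L` has at least `N` fixed points
(the negation of the POOR hypothesis of the live line's core, up to the exact threshold). -/
def Rich (μ : Fin 3 → Equiv.Perm (Fin n)) (L N : ℕ) : Prop :=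
  ∃ z : List (Fin 3), z ≠ [] ∧ z.length ≤ L ∧ List.IsChain (· ≠ ·) (z ++ z) ∧
    N ≤ ((Finset.univ : Finset (Fin n)).filter (fun x => z.foldl (fun v b => μ b v) x = x)).card

/-- MANY GADGETS: `g` support-disjoint commuting local involution triples (verbatim the conclusion format of the sibling's
`stub_localTriples` / `LocalTriples`). -/
def ManyGadgets (μ : Fin 3 → Equiv.Perm (Fin n)) (g : ℕ) : Prop :=
  ∃ (a b : Fin g → Equiv.Perm (Fin n)),
    (∀ j, a j * a j = 1 ∧ b j * b j = 1 ∧ a j * b j = b j * a j ∧ (a j ≠ 1 ∨ b j ≠ 1) ∧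
      a j * μ 0 = μ 0 * a j ∧ b j * μ 1 = μ 1 * b j ∧ a j * b j * μ 2 = μ 2 * (a j * b j)) ∧
    (∀ j j' : Fin g, j ≠ j' → ∀ v, (a j v ≠ v ∨ b j v ≠ v) → a j' v = v ∧ b j' v = v)

/-- **(LML)** — local-monodromy lemma at CONSTANT rate (crux NOTES §15.2): for every rate `K` and radius `R` there are a richness
exponent window and `n₀` such that every host on `n ≥ n₀` points, at every scale `m` with `Nat.log 2 n ≤ m ≤ 3 * Nat.log 2 n`,
either has few local hits (`K · localHits ≤ T_m`), or is rich (a word of length `≤ m ^ 2` with `≥ n^{3/4}` fixed points), or has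
`≥ √n` support-disjoint gadgets.  (The reflection bookkeeping of §15.2 needs this only for `K ≈ 500·D`, `R = O(log D)`.) -/
def LML : Prop :=
  ∀ K R : ℕ, ∃ n₀ : ℕ, ∀ n ≥ n₀, ∀ μ : Fin 3 → Equiv.Perm (Fin n), (∀ b, μ b * μ b = 1) → (∀ b v, μ b v ≠ v) →
    ∀ m : ℕ, Nat.log 2 n ≤ m → m ≤ 3 * Nat.log 2 n →
      K * localHits μ m R ≤ (closedWalks μ m).card ∨
      Rich μ (m ^ 2) (Nat.sqrt (n * Nat.sqrt n)) ∨   -- threshold ≈ n^{3/4}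
      ManyGadgets μ (Nat.sqrt n)

/-- A CELL of multiplicity `≥ M` at half-length `L` from the ordered pair `(P, Y)`, `P ≠ Y` (crux NOTES §15.3 (R2)/(R3)): at least
`M` words `β` of length `L` with a common image pair `(P·β, Y·β) = (Q, Q'')`.  By (R2) an (LML)-violator at scale `2L` must have such
cells with `M ≥ 2^{L - log₂ n}/K` at near-diagonal pairs of a constant fraction of its vertices. -/
def HasHotCell (μ : Fin 3 → Equiv.Perm (Fin n)) (L M : ℕ) (P Y : Fin n) : Prop :=
  ∃ Q Q'' : Fin n, M ≤ ((words L).filter (fun β => List.IsChain (· ≠ ·) β ∧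
    β.foldl (fun v b => μ b v) P = Q ∧ β.foldl (fun v b => μ b v) Y = Q'')).card

/-- **(BQ)** — bouquet lemma (crux NOTES §15.7), one admissible precise form: for every radius `R` there is a multiplicity
threshold function `M(n) ≤ (log₂ n)^A` such that a host in which some near-diagonal pair `(P, Y)` (`Y = P·a`, `0 < |a| ≤ R`) carries
a cell of multiplicity `≥ M(n)` at some half-length `L ≤ 2 log₂ n` contains a clean closed rung walk of length `≤ 4L` THROUGH A POINT
OF THAT CELL — here weakened to: is rich or has a gadget (`ManyGadgets μ 1`).  Pattern-level calibration (§15.7): for `L ≤ 3`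
multiplicity `2` suffices; for larger `L` pattern-cliques grow (1, 3, 6, 7 at L = 3..6), so the proof must use the embedding. -/
def BQ : Prop :=
  ∀ R : ℕ, ∃ A n₀ : ℕ, ∀ n ≥ n₀, ∀ μ : Fin 3 → Equiv.Perm (Fin n), (∀ b, μ b * μ b = 1) → (∀ b v, μ b v ≠ v) →
    ∀ (P : Fin n) (a : List (Fin 3)), a ≠ [] → a.length ≤ R → List.IsChain (· ≠ ·) a →
      ∀ L ≤ 2 * Nat.log 2 n, HasHotCell μ L ((Nat.log 2 n) ^ A) P (a.foldl (fun v b => μ b v) P) →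
        Rich μ (4 * L) (Nat.sqrt (n * Nat.sqrt n)) ∨ ManyGadgets μ 1

end Summit.MatrixMultiplication.MatrixMultiplication.Cruxes.HyperoctahedralThreshold.ReflectionRoute
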